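import Literature.Computability.Complexity.CountingHierarchyProofs
import Literature.Computability.Complexity.CoinCounting
import Literature.Computability.Complexity.TimeBoundsComplProofs
import Literature.Computability.Complexity.PolyHierarchy
import HarnessLib

/-!
# `PP` and the levels of `CH` are closed under complement; `PH ⊆ CH` (proofs; trunk CplxCore)

Sibling proof file of `CountingHierarchy.lean` (D-0014), continuing `CountingHierarchyProofs.lean`.
All PROVED, from the tree's `FinTM2` toolkit (transducers, `StringCopy.lean`, `PairProjections.lean`):

* (counting API for `uniformProb` in `CoinCounting.lean`: `cnt`, `half_lt_uniformProb_iff`,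
  `cnt_succ`, …);
* `mem_P_of_fst` — a language decided by a finite-state transducer is in `P` (regular ⊆ P), and the
  regular languages used below (`sndStartsWith b`, the tie-breaking set `tieSet`);
* (`compl_mem_P_iff`, `co_P_holds`: `Classes.lean`);
* `compl_mem_pMajority` — **Gill's trick**: if `K ∋` all of `P` is closed under polynomial-time
  preimages and under complement, then `C'·K` is closed under complement: with one extra coin `b`,
  accept `0y` iff `y` was rejecting and `1y` iff `y ∈ tieSet` (`|tieSet ∩ {0,1}^m| = 2^{m-1} + 1`),
  so that "at most half accepting" becomes "strictly more than half" (Gill 1977, closure of `PP`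
  under complement; Torán 1991, §3);
* `polyExists_subset_pMajority` — **`∃·K ⊆ C'·K`** (Bürgisser 2009, Rem. 2.2; Torán 1991, §3): one
  extra coin, `1y'` always accepts, `0y'` accepts iff the self-delimited prefix decoded from `y'`
  (cells `1b`, padding `0…`) is a witness — witnesses of every length `≤ p(|x|)` are thus counted
  among coin strings of the single length `2p(|x|)`;
* `CkP_closed_compl`, `co_CkP`, **`co_PP : co PP = PP`** (Gill 1977), `polyExists_CkP_subset_succ`,
  `SigmaP_subset_CkP` (`Σₖᵖ ⊆ CₖP`) and **`PH_subset_CH_holds`** — discharge of the named fact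
  `PH_subset_CH` (Bürgisser 2009, §2.1: "It follows from Remark 2.2 that … PH … is contained in CH").

## References

* J. Gill, *Computational complexity of probabilistic Turing machines*, SIAM J. Comput. 6 (1977)
  675–695, §5 (closure of `PP` under complement).
* J. Torán, *Complexity classes defined by counting quantifiers*, J. ACM 38 (1991) 753–774, §3.
* P. Bürgisser, *On defining integers and proving arithmetic circuit lower bounds*, Comput.
  Complexity 18 (2009) = ECCC TR06-113, §2.1, Rem. 2.2.
* S. Arora, B. Barak, *Computational Complexity: A Modern Approach*, CUP 2009, §17.2.1, Def. 5.3.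
-/

namespace Literature.Computability.Complexity

open _root_.Computability Polynomial

/-! ### Languages decided by finite-state transducers are in `P` -/

/-- **Regular languages are in `P`**: if a finite-state transducer outputs `[1]` exactly on `L` and
`[0]` elsewhere, then `L ∈ P` (its machine runs in linear time; `FST.polyTimeComputable_eval`).
[Arora–Barak 2009, Def. 1.13; Hopcroft–Ullman 1979, §2.7] [folklore] -/
theorem mem_P_of_fst {σ : Type} [Fintype σ] (T : FST σ Bool Bool) (L : Language Bool)
    (h : ∀ w, (w ∈ L → T.eval w = [true]) ∧ (w ∉ L → T.eval w = [false])) : L ∈ Classes.P := by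
  classical
  obtain ⟨p, M, hM⟩ := T.polyTimeComputable_eval
  refine mem_P_iff_holds.2 (polyTimeDecidable_iff.2 ⟨p, M, fun w => ?_⟩)
  have hw := hM w
  have he : (id (T.eval w) : List Bool) = encodeBool (L.boolIndicator w) := by
    by_cases hx : w ∈ L
    · rw [id, (h w).1 hx, (Set.mem_iff_boolIndicator _ _).1 hx]; rfl
    · rw [id, (h w).2 hx, (Set.notMem_iff_boolIndicator _ _).1 hx]; rfl
  rw [he] at hw
  exact hw

namespace RegLang

/-- Decider states for "the string starts with `b`": nothing read yet, or the first symbol. [folklore] -/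
inductive HS
  | ini
  | fst (c : Bool)
  deriving DecidableEq, Fintype

/-- Transition of `startsWithT`: remember the first symbol. [folklore] -/
def startsWithStep : HS → Bool → HS × List Bool
  | .ini, c => (.fst c, [])
  | .fst c, _ => (.fst c, [])

/-- The transducer deciding `{w | w.head? = some b}` (verdict via `front`, body discarded). [folklore] -/
def startsWithT (b : Bool) : FST HS Bool Bool where
  init := .ini
  step := startsWithStep
  front := fun s => [decide (s = .fst b)]
  keep := fun _ => false

/-- The transition of `startsWithT` (definitional). [folklore] -/
@[simp] theorem startsWithT_step (b : Bool) (s : HS) (c : Bool) :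
    (startsWithT b).step s c = startsWithStep s c := rfl

/-- The verdict of `startsWithT b` is read off the final state. [folklore] -/
theorem startsWithT_eval_eq (b : Bool) (w : List Bool) :
    (startsWithT b).eval w = [decide (((startsWithT b).run .ini w).1 = .fst b)] := by
  simp [FST.eval, startsWithT]

/-- The run of `startsWithT` keeps the remembered first symbol. [folklore] -/
theorem startsWithT_run_fst (b c : Bool) (w : List Bool) :
    ((startsWithT b).run (.fst c) w).1 = .fst c := by
  induction w with
  | nil => rfl
  | cons x w ih => simpa [FST.run_cons, startsWithStep] using ih

/-- `startsWithT b` decides `{w | w.head? = some b}`. [folklore] -/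
theorem startsWithT_eval (b : Bool) (w : List Bool) :
    (startsWithT b).eval w = [decide (w.head? = some b)] := by
  rw [startsWithT_eval_eq]
  cases w with
  | nil => simp
  | cons c w => simp [FST.run_cons, startsWithStep, startsWithT_run_fst]

/-- Decider states for `1 · tieSet`: nothing read; the leading `1` read and the tail empty so far;
the tail started with `0` (accept); the tail nonempty without `0` so far; rejected. [folklore] -/
inductive TS
  | pre
  | st1
  | acc
  | allones
  | rej
  deriving DecidableEq, Fintype

/-- Transition of `oneTieT`. [folklore] -/
def oneTieStep : TS → Bool → TS × List Bool
  | .pre, true => (.st1, [])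
  | .pre, false => (.rej, [])
  | .st1, false => (.acc, [])
  | .st1, true => (.allones, [])
  | .acc, _ => (.acc, [])
  | .allones, true => (.allones, [])
  | .allones, false => (.rej, [])
  | .rej, _ => (.rej, [])

/-- Whether a state of `oneTieT` is accepting. [folklore] -/
def TS.accepting : TS → Bool
  | .st1 => true
  | .acc => true
  | .allones => true
  | _ => false

/-- The transducer deciding `{1y | y ∈ tieSet}` (`tieSet = {y | y.head? = some 0 ∨ 0 ∉ y}`). [folklore] -/
def oneTieT : FST TS Bool Bool where
  init := .pre
  step := oneTieStep
  front := fun s => [s.accepting]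
  keep := fun _ => false

/-- The transition of `oneTieT` (definitional). [folklore] -/
@[simp] theorem oneTieT_step (s : TS) (c : Bool) : oneTieT.step s c = oneTieStep s c := rfl

/-- The verdict of `oneTieT` is read off the final state. [folklore] -/
theorem oneTieT_eval_eq (w : List Bool) : oneTieT.eval w = [(oneTieT.run .pre w).1.accepting] := by
  simp [FST.eval, oneTieT]

/-- Absorbing state `acc`. [folklore] -/
theorem oneTieT_run_acc (w : List Bool) : (oneTieT.run .acc w).1 = .acc := by
  induction w with
  | nil => rfl
  | cons x w ih => simpa [FST.run_cons, oneTieStep] using ih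

/-- Absorbing state `rej`. [folklore] -/
theorem oneTieT_run_rej (w : List Bool) : (oneTieT.run .rej w).1 = .rej := by
  induction w with
  | nil => rfl
  | cons x w ih => simpa [FST.run_cons, oneTieStep] using ih

/-- From `allones` the run is accepting iff no `0` follows. [folklore] -/
theorem oneTieT_run_allones (w : List Bool) :
    (oneTieT.run .allones w).1.accepting = decide (false ∉ w) := by
  induction w with
  | nil => simp [TS.accepting]
  | cons x w ih =>
    cases x
    · simp [FST.run_cons, oneTieStep, oneTieT_run_rej, TS.accepting]
    · simpa [FST.run_cons, oneTieStep] using ih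

end RegLang

/-- The **tie-breaking set** of Gill's complementation trick: strings starting with `0`, and the
strings without `0`; `2^{m} + 1` of them have length `m + 1`, one has length `0` (`cnt_tieSet_succ`,
`cnt_tieSet_zero`). [Gill 1977, §5] [folklore] -/
def tieSet : Set (List Bool) :=
  {y | y.head? = some false ∨ false ∉ y}

/-- Membership in `tieSet` is decidable (its defining condition is). [folklore] -/
instance : DecidablePred (· ∈ tieSet) := fun y =>
  inferInstanceAs (Decidable (y.head? = some false ∨ false ∉ y))

/-- Membership in `tieSet` (definitional). [folklore] -/
@[simp] theorem mem_tieSet (y : List Bool) : y ∈ tieSet ↔ y.head? = some false ∨ false ∉ y := Iff.rfl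

/-- `oneTieT` decides `{c | c.head? = some 1 ∧ c.tail ∈ tieSet}`. [folklore] -/
theorem RegLang.oneTieT_eval (c : List Bool) :
    RegLang.oneTieT.eval c = [decide (c.head? = some true ∧ c.tail ∈ tieSet)] := by
  rw [RegLang.oneTieT_eval_eq]
  rcases c with _ | ⟨x, y⟩
  · simp [RegLang.TS.accepting]
  · cases x
    · simp [FST.run_cons, RegLang.oneTieStep, RegLang.oneTieT_run_rej, RegLang.TS.accepting]
    · rcases y with _ | ⟨z, y⟩
      · simp [FST.run_cons, RegLang.oneTieStep, RegLang.TS.accepting]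
      · cases z
        · simp [FST.run_cons, RegLang.oneTieStep, RegLang.oneTieT_run_acc, RegLang.TS.accepting]
        · simp [FST.run_cons, RegLang.oneTieStep, RegLang.oneTieT_run_allones]

/-- Counting the tie set: `2^m + 1` strings of length `m + 1` (all `0y`, and `1^{m+1}`).
[Gill 1977, §5] [folklore] -/
theorem cnt_tieSet_succ (m : ℕ) : cnt (m + 1) tieSet = 2 ^ m + 1 := by
  rw [cnt_succ]
  have h0 : cnt m {y : List Bool | false :: y ∈ tieSet} = 2 ^ m :=
    cnt_eq_two_pow_of_forall fun y _ => by simp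
  have h1 : cnt m {y : List Bool | true :: y ∈ tieSet} = 1 := by
    rw [← cnt_noFalse m]
    exact cnt_congr fun y _ => by simp
  rw [h0, h1]

/-- Counting the tie set at length `0`: only `[]`. [folklore] -/
theorem cnt_tieSet_zero : cnt 0 tieSet = 1 := by
  rw [cnt_zero]
  simp

/-! ### The regular languages of the constructions -/

/-- `sndStartsWith b`: the strings whose second `boolUnpair` component starts with `b`. [folklore] -/
def sndStartsWith (b : Bool) : Language Bool :=
  {w | ((boolUnpair w).2).head? = some b}

/-- `sndStartsWith b ∈ P` (a transducer after the second projection). [folklore] -/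
theorem sndStartsWith_mem_P (b : Bool) : sndStartsWith b ∈ Classes.P := by
  have hL : ({c | c.head? = some b} : Language Bool) ∈ Classes.P :=
    mem_P_of_fst (RegLang.startsWithT b) _ fun w =>
      ⟨fun hw => by
          have hw' : w.head? = some b := hw
          rw [RegLang.startsWithT_eval, decide_eq_true hw'],
        fun hw => by
          have hw' : ¬ w.head? = some b := hw
          rw [RegLang.startsWithT_eval, decide_eq_false hw']⟩
  exact preimage_mem_P (f := fun z => (boolUnpair z).2) hL boolUnpairSnd_mem_FP

/-- Membership of a pair in `sndStartsWith`. [folklore] -/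
@[simp] theorem boolPair_mem_sndStartsWith (b : Bool) (x c : List Bool) :
    boolPair x c ∈ sndStartsWith b ↔ c.head? = some b := by
  change ((boolUnpair (boolPair x c)).2).head? = some b ↔ _
  rw [boolUnpair_boolPair]

/-- `sndOneTie`: the strings whose second component is `1y` with `y ∈ tieSet`. [folklore] -/
def sndOneTie : Language Bool :=
  {w | ((boolUnpair w).2).head? = some true ∧ ((boolUnpair w).2).tail ∈ tieSet}

/-- `sndOneTie ∈ P`. [folklore] -/
theorem sndOneTie_mem_P : sndOneTie ∈ Classes.P := by
  have hL : ({c | c.head? = some true ∧ c.tail ∈ tieSet} : Language Bool) ∈ Classes.P :=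
    mem_P_of_fst RegLang.oneTieT _ fun w =>
      ⟨fun hw => by
          have hw' : w.head? = some true ∧ w.tail ∈ tieSet := hw
          rw [RegLang.oneTieT_eval, decide_eq_true hw'],
        fun hw => by
          have hw' : ¬ (w.head? = some true ∧ w.tail ∈ tieSet) := hw
          rw [RegLang.oneTieT_eval, decide_eq_false hw']⟩
  exact preimage_mem_P (f := fun z => (boolUnpair z).2) hL boolUnpairSnd_mem_FP

/-- Membership of a pair in `sndOneTie`. [folklore] -/
theorem boolPair_mem_sndOneTie (x : List Bool) (b : Bool) (y : List Bool) :
    boolPair x (b :: y) ∈ sndOneTie ↔ b = true ∧ y ∈ tieSet := by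
  change ((boolUnpair (boolPair x (b :: y))).2).head? = some true ∧
      ((boolUnpair (boolPair x (b :: y))).2).tail ∈ tieSet ↔ _
  rw [boolUnpair_boolPair]
  simp

/-! ### Dropping the first coin; decoding a self-delimited witness -/

namespace CoinMaps

/-- States shared by the two coin transducers: pair reader, the coin to drop, then either the
verbatim copier (`copy`) or the cell decoder (`c0`, `c1`), and a dead state. [folklore] -/
inductive S
  | ev
  | od (b : Bool)
  | drop
  | copy
  | c0
  | c1
  | dead
  deriving DecidableEq, Fintype

/-- Transition of `dropT`: `⟨x, b y⟩ ↦ ⟨x, y⟩`. [folklore] -/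
def dropStep : S → Bool → S × List Bool
  | .ev, b => (.od b, [])
  | .od b, b' => (if b = b' then .ev else .drop, [b, b'])
  | .drop, _ => (.copy, [])
  | .copy, b => (.copy, [b])
  | s, _ => (s, [])

/-- Transition of `decT`: `⟨x, b y'⟩ ↦ ⟨x, dec y'⟩` (cells `1c ↦ c`, stop at `0`). [folklore] -/
def decStep : S → Bool → S × List Bool
  | .ev, b => (.od b, [])
  | .od b, b' => (if b = b' then .ev else .drop, [b, b'])
  | .drop, _ => (.c0, [])
  | .c0, true => (.c1, [])
  | .c0, false => (.dead, [])
  | .c1, c => (.c0, [c])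
  | s, _ => (s, [])

/-- The coin-dropping transducer. [folklore] -/
def dropT : FST S Bool Bool where
  init := .ev
  step := dropStep
  front := fun _ => []
  keep := fun _ => true

/-- The witness-decoding transducer. [folklore] -/
def decT : FST S Bool Bool where
  init := .ev
  step := decStep
  front := fun _ => []
  keep := fun _ => true

/-- The transition of `dropT` (definitional). [folklore] -/
@[simp] theorem dropT_step (s : S) (b : Bool) : dropT.step s b = dropStep s b := rfl

/-- The transition of `decT` (definitional). [folklore] -/
@[simp] theorem decT_step (s : S) (b : Bool) : decT.step s b = decStep s b := rfl

/-- The transduction of `dropT` is the body from `ev`. [folklore] -/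
@[simp] theorem dropT_eval_eq (w : List Bool) : dropT.eval w = (dropT.run .ev w).2 := by
  simp [FST.eval, dropT]

/-- The transduction of `decT` is the body from `ev`. [folklore] -/
@[simp] theorem decT_eval_eq (w : List Bool) : decT.eval w = (decT.run .ev w).2 := by
  simp [FST.eval, decT]

/-- The self-delimiting decoder of coin strings: cells `1c` contribute `c`, a `0` (or the end)
stops. [folklore] -/
def dec : List Bool → List Bool
  | true :: c :: r => c :: dec r
  | _ => []

/-- The encoder: `enc y = (1 y₁) (1 y₂) ⋯`. [folklore] -/
def enc (y : List Bool) : List Bool :=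
  y.flatMap fun c => [true, c]

/-- Decoding takes at most half of the coins: `2 |dec r| ≤ |r|`. [folklore] -/
theorem two_mul_length_dec_le : ∀ r : List Bool, 2 * (dec r).length ≤ r.length
  | [] => by simp [dec]
  | [b] => by cases b <;> simp [dec]
  | true :: c :: r => by have := two_mul_length_dec_le r; simp [dec]; omega
  | false :: c :: r => by simp [dec]

/-- Decoding an encoded witness followed by zero padding. [folklore] -/
theorem dec_enc_append_replicate (y : List Bool) (j : ℕ) :
    dec (enc y ++ List.replicate j false) = y := by
  induction y with
  | nil => cases j <;> simp [enc, dec, List.replicate_succ]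
  | cons c y ih => simpa [enc, dec] using ih

/-- `|enc y| = 2|y|`. [folklore] -/
@[simp] theorem length_enc (y : List Bool) : (enc y).length = 2 * y.length := by
  induction y with
  | nil => rfl
  | cons c y ih => simp [enc, List.flatMap_cons] at ih ⊢; omega

/-- The copier of `dropT`. [folklore] -/
theorem dropT_run_copy (w : List Bool) : (dropT.run .copy w).2 = w := by
  induction w with
  | nil => rfl
  | cons b w ih => simpa [FST.run_cons, dropStep] using ih

/-- The pair reader of `dropT` copies the first component and the separator. [folklore] -/
theorem dropT_run_ev (u w : List Bool) :
    (dropT.run .ev (boolPair u w)).2 = boolPair u (dropT.run .drop w).2 := by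
  induction u with
  | nil => simp [CoinTrunc.boolPair_nil, FST.run_cons, dropStep]
  | cons b u ih => simp [CoinTrunc.boolPair_cons, FST.run_cons, dropStep, ih]

/-- **`dropT ⟨x, b y⟩ = ⟨x, y⟩`.** [folklore] -/
theorem dropT_eval (x : List Bool) (b : Bool) (y : List Bool) :
    dropT.eval (boolPair x (b :: y)) = boolPair x y := by
  rw [dropT_eval_eq, dropT_run_ev]
  simp [FST.run_cons, dropStep, dropT_run_copy]

/-- The dead state of `decT` emits nothing. [folklore] -/
theorem decT_run_dead (w : List Bool) : (decT.run .dead w).2 = [] := by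
  induction w with
  | nil => rfl
  | cons b w ih => simpa [FST.run_cons, decStep] using ih

/-- The cell decoder of `decT` computes `dec`. [folklore] -/
theorem decT_run_c0 : ∀ w : List Bool, (decT.run .c0 w).2 = dec w
  | [] => rfl
  | [b] => by cases b <;> simp [FST.run_cons, decStep, dec]
  | true :: c :: r => by simp [FST.run_cons, decStep, dec, decT_run_c0 r]
  | false :: c :: r => by simp [FST.run_cons, decStep, dec, decT_run_dead]

/-- The pair reader of `decT` copies the first component and the separator. [folklore] -/
theorem decT_run_ev (u w : List Bool) :
    (decT.run .ev (boolPair u w)).2 = boolPair u (decT.run .drop w).2 := by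
  induction u with
  | nil => simp [CoinTrunc.boolPair_nil, FST.run_cons, decStep]
  | cons b u ih => simp [CoinTrunc.boolPair_cons, FST.run_cons, decStep, ih]

/-- **`decT ⟨x, b y'⟩ = ⟨x, dec y'⟩`.** [folklore] -/
theorem decT_eval (x : List Bool) (b : Bool) (y : List Bool) :
    decT.eval (boolPair x (b :: y)) = boolPair x (dec y) := by
  rw [decT_eval_eq, decT_run_ev]
  simp [FST.run_cons, decStep, decT_run_c0]

end CoinMaps

/-- `dropT.eval ∈ FP`. [folklore] -/
theorem CoinMaps.dropT_mem_FP : CoinMaps.dropT.eval ∈ FP :=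
  CoinMaps.dropT.polyTimeComputable_eval

/-- `decT.eval ∈ FP`. [folklore] -/
theorem CoinMaps.decT_mem_FP : CoinMaps.decT.eval ∈ FP :=
  CoinMaps.decT.polyTimeComputable_eval

/-! ### `∃·K ⊆ C'·K` -/

/-- **The existential operator is majorised by the majority operator**: if `K ⊇ P` is closed
under polynomial-time preimages then `∃·K ⊆ C'·K` (Bürgisser 2009, Rem. 2.2: "It is clear that
`K ⊆ ∃·K ⊆ C·K`"; Torán 1991, §3; for `K = P` this is Gill's `NP ⊆ PP`). Construction: with
`2p(n) + 1` coins `b y'`, accept if `b = 1`, and if `b = 0` accept iff `⟨x, dec y'⟩ ∈ L'`, where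
`dec` reads the self-delimited prefix of `y'` (so witnesses of all lengths `≤ p(n)` are counted at
the single coin length `2p(n)`); the count exceeds half iff some witness exists. [cite: Burgisser2006, Remark 2.2] -/
theorem polyExists_subset_pMajority {K : Set (Language Bool)}
    (hK : ∀ ⦃L : Language Bool⦄, L ∈ K → ∀ ⦃g : List Bool → List Bool⦄, g ∈ FP → g ⁻¹' L ∈ K)
    (hPK : Classes.P ⊆ K) : polyExists K ⊆ pMajority K := by
  rintro L ⟨L', hL', p, hp⟩
  set W : Language Bool :=
    sndStartsWith true ⊔ (sndStartsWith false ⊓ CoinMaps.decT.eval ⁻¹' L') with hW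
  have hWK : W ∈ K :=
    union_mem_of_preimage_closed hK hPK (sndStartsWith_mem_P true)
      (inter_mem_of_preimage_closed hK hPK (sndStartsWith_mem_P false)
        (hK hL' CoinMaps.decT_mem_FP))
  have hmemW : ∀ (x : List Bool) (b : Bool) (y : List Bool), boolPair x (b :: y) ∈ W ↔
      b = true ∨ (b = false ∧ boolPair x (CoinMaps.dec y) ∈ L') := by
    intro x b y
    change (boolPair x (b :: y) ∈ sndStartsWith true ∨
      (boolPair x (b :: y) ∈ sndStartsWith false ∧
        CoinMaps.decT.eval (boolPair x (b :: y)) ∈ L')) ↔ _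
    rw [boolPair_mem_sndStartsWith, boolPair_mem_sndStartsWith, CoinMaps.decT_eval]
    simp
  refine ⟨W, hWK, 2 * p + 1, fun x => ?_⟩
  rw [hp x, half_lt_uniformProb_iff]
  have hm : (2 * p + 1 : ℕ[X]).eval x.length = 2 * p.eval x.length + 1 := by simp
  rw [hm, cnt_succ]
  generalize p.eval x.length = q
  have h1 : cnt (2 * q) {y : List Bool | true :: y ∈ {c : List Bool | boolPair x c ∈ W}} =
      2 ^ (2 * q) :=
    cnt_eq_two_pow_of_forall fun y _ => by
      change boolPair x (true :: y) ∈ W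
      rw [hmemW]; exact Or.inl rfl
  have h0 : cnt (2 * q) {y : List Bool | false :: y ∈ {c : List Bool | boolPair x c ∈ W}} =
      cnt (2 * q) {y | boolPair x (CoinMaps.dec y) ∈ L'} :=
    cnt_congr fun y _ => by
      change boolPair x (false :: y) ∈ W ↔ boolPair x (CoinMaps.dec y) ∈ L'
      rw [hmemW]; simp
  rw [h0, h1]
  rw [show 2 ^ (2 * q + 1) < 2 * (cnt (2 * q) {y | boolPair x (CoinMaps.dec y) ∈ L'} + 2 ^ (2 * q)) ↔
      0 < cnt (2 * q) {y | boolPair x (CoinMaps.dec y) ∈ L'} by rw [pow_succ]; omega]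
  rw [cnt_pos_iff]
  constructor
  · rintro ⟨y, hy, hyL⟩
    refine ⟨CoinMaps.enc y ++ List.replicate (2 * q - 2 * y.length) false, ?_, ?_⟩
    · simp; omega
    · change boolPair x (CoinMaps.dec (CoinMaps.enc y ++ List.replicate _ false)) ∈ L'
      rwa [CoinMaps.dec_enc_append_replicate]
  · rintro ⟨y', hy', hmem⟩
    have hlen := CoinMaps.two_mul_length_dec_le y'
    exact ⟨CoinMaps.dec y', by omega, hmem⟩

/-! ### Gill's trick: `C'·K` is closed under complement -/

/-- **Complementation of majority classes** (Gill 1977, §5, closure of `PP` under complement,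
relativised): if `K ⊇ P` is closed under polynomial-time preimages and under complement, then
`L ∈ C'·K ⇒ Lᶜ ∈ C'·K`. With one extra coin `b y` (`|y| = p(n) = m`): accept `0y` iff
`⟨x, y⟩ ∉ L''`, and `1y` iff `y ∈ tieSet` (`2^{m-1} + 1` strings for `m ≥ 1`, one for `m = 0`);
then `#acc = #rej(x) + |tieSet ∩ {0,1}^m| > 2^m` iff `#acc(x) ≤ 2^{m-1}` iff `x ∉ L`. [cite: Gill1977, §5] -/
theorem compl_mem_pMajority {K : Set (Language Bool)}
    (hK : ∀ ⦃L : Language Bool⦄, L ∈ K → ∀ ⦃g : List Bool → List Bool⦄, g ∈ FP → g ⁻¹' L ∈ K)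
    (hPK : Classes.P ⊆ K) (hco : ∀ ⦃L : Language Bool⦄, L ∈ K → Lᶜ ∈ K)
    {L : Language Bool} (hL : L ∈ pMajority K) : Lᶜ ∈ pMajority K := by
  obtain ⟨L'', hL'', p, hp⟩ := hL
  set W : Language Bool :=
    sndOneTie ⊔ (sndStartsWith false ⊓ CoinMaps.dropT.eval ⁻¹' L''ᶜ) with hW
  have hWK : W ∈ K :=
    union_mem_of_preimage_closed hK hPK sndOneTie_mem_P
      (inter_mem_of_preimage_closed hK hPK (sndStartsWith_mem_P false)
        (hK (hco hL'') CoinMaps.dropT_mem_FP))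
  have hmemW : ∀ (x : List Bool) (b : Bool) (y : List Bool), boolPair x (b :: y) ∈ W ↔
      (b = true ∧ y ∈ tieSet) ∨ (b = false ∧ boolPair x y ∉ L'') := by
    intro x b y
    change (boolPair x (b :: y) ∈ sndOneTie ∨
      (boolPair x (b :: y) ∈ sndStartsWith false ∧
        CoinMaps.dropT.eval (boolPair x (b :: y)) ∈ L''ᶜ)) ↔ _
    rw [boolPair_mem_sndOneTie, boolPair_mem_sndStartsWith, CoinMaps.dropT_eval]
    simp only [List.head?_cons, Option.some.injEq]
    rfl
  refine ⟨W, hWK, p + 1, fun x => ?_⟩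
  change x ∉ L ↔ _
  rw [hp x, half_lt_uniformProb_iff, half_lt_uniformProb_iff]
  simp only [eval_add, eval_one]
  rw [cnt_succ]
  generalize p.eval x.length = m
  have hAR := cnt_add_cnt_compl m {c : List Bool | boolPair x c ∈ L''}
  have h1 : cnt m {y : List Bool | true :: y ∈ {c : List Bool | boolPair x c ∈ W}} = cnt m tieSet :=
    cnt_congr fun y _ => by
      change boolPair x (true :: y) ∈ W ↔ y ∈ tieSet
      rw [hmemW]; simp
  have h0 : cnt m {y : List Bool | false :: y ∈ {c : List Bool | boolPair x c ∈ W}} =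
      cnt m {c : List Bool | boolPair x c ∈ L''}ᶜ :=
    cnt_congr fun y _ => by
      change boolPair x (false :: y) ∈ W ↔ ¬ boolPair x y ∈ L''
      rw [hmemW]; simp
  rw [h0, h1]
  rcases m with _ | k
  · rw [cnt_tieSet_zero]
    simp only [pow_zero] at hAR ⊢
    omega
  · rw [cnt_tieSet_succ]
    rw [pow_succ] at hAR
    rw [pow_succ, pow_succ]
    omega

/-! ### Consequences for `PP`, `CₖP`, `CH` and `PH` -/

/-- **Discharge of `NP_subset_PP`** (`NP = ∃·P ⊆ C'·P = PP`; Gill 1977, Thm. 6.5). [cite: Gill1977, Thm. 6.5] -/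
theorem NP_subset_PP_holds : NP_subset_PP :=
  polyExists_subset_pMajority (fun _ hL _ hg => preimage_mem_P hL hg) le_rfl

/-- **The levels of the counting hierarchy are closed under complement.** [cite: Toran1991, §3] -/
theorem CkP_closed_compl (k : ℕ) : ∀ ⦃L : Language Bool⦄, L ∈ CkP k → Lᶜ ∈ CkP k := by
  induction k with
  | zero => intro L hL; exact compl_mem_P_iff.2 hL
  | succ k ih =>
    intro L hL
    exact compl_mem_pMajority (preimage_mem_CkP k) (P_subset_CkP k) ih hL

/-- `co CₖP = CₖP`. [cite: Toran1991, §3] -/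
theorem co_CkP (k : ℕ) : co (CkP k) = CkP k := by
  ext L
  refine ⟨fun h => ?_, fun h => CkP_closed_compl k h⟩
  have h' : Lᶜᶜ ∈ CkP k := CkP_closed_compl k h
  rwa [compl_compl] at h'

/-- **`co PP = PP`**: `PP` is closed under complement (Gill 1977, §5). [cite: Gill1977, §5] -/
theorem co_PP : co PP = PP :=
  co_CkP 1

/-- `PP` is closed under complement, membership form. [cite: Gill1977, §5] -/
theorem compl_mem_PP {L : Language Bool} (hL : L ∈ PP) : Lᶜ ∈ PP :=
  CkP_closed_compl 1 hL

/-- `CH` is closed under complement. [cite: Toran1991, §3] -/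
theorem compl_mem_CH {L : Language Bool} (hL : L ∈ CH) : Lᶜ ∈ CH := by
  obtain ⟨k, hk⟩ := mem_CH_iff.1 hL
  exact CkP_subset_CH k (CkP_closed_compl k hk)

/-- `co CH = CH`. [cite: Toran1991, §3] -/
theorem co_CH : co CH = CH := by
  ext L
  refine ⟨fun h => ?_, fun h => compl_mem_CH h⟩
  have h' : Lᶜᶜ ∈ CH := compl_mem_CH h
  rwa [compl_compl] at h'

/-- `∃·CₖP ⊆ Cₖ₊₁P` (Bürgisser 2009, Rem. 2.2). [cite: Burgisser2006, Remark 2.2] -/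
theorem polyExists_CkP_subset_succ (k : ℕ) : polyExists (CkP k) ⊆ CkP (k + 1) :=
  polyExists_subset_pMajority (preimage_mem_CkP k) (P_subset_CkP k)

/-- **`Σₖᵖ ⊆ CₖP`** for every `k` (induction: `Σₖ₊₁ = ∃·coΣₖ ⊆ ∃·coCₖP = ∃·CₖP ⊆ Cₖ₊₁P`).
[cite: Burgisser2006, §2.1] -/
theorem SigmaP_subset_CkP (k : ℕ) : SigmaP k ⊆ CkP k := by
  induction k with
  | zero => exact le_rfl
  | succ k ih =>
    intro L hL
    rw [SigmaP_succ, PiP_eq_co] at hL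
    have h1 : polyExists (co (SigmaP k)) ⊆ polyExists (co (CkP k)) := polyExists_mono (co_mono ih)
    have h2 := h1 hL
    rw [co_CkP] at h2
    exact polyExists_CkP_subset_succ k h2

/-- **Discharge of `PH_subset_CH`**: the polynomial hierarchy is contained in the counting
hierarchy (Bürgisser 2009, §2.1: "It follows from Remark 2.2 that … PH … is contained in CH";
Torán 1991, §3). [cite: Burgisser2006, §2.1] -/
theorem PH_subset_CH_holds : PH_subset_CH := by
  intro L hL
  obtain ⟨k, hk⟩ := Set.mem_iUnion.1 hL
  exact CkP_subset_CH k (SigmaP_subset_CkP k hk)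

/-- `NP ⊆ CH`. [cite: Burgisser2006, §2.1] -/
theorem NP_subset_CH : Nondeterministic.NP ⊆ CH :=
  fun _ hL => CkP_subset_CH 1 (NP_subset_PP_holds hL)

end Literature.Computability.Complexity
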